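import Mathlib
import Summits.Ventures.PercRepro2.LocRows
import Summits.Ventures.PercRepro2.SwRow
import Summits.Ventures.PercRepro2.SwOut
import Summits.Ventures.PercRepro2.SwAllRow
import Summits.Ventures.PercRepro2.SwOutAll
import Summits.Ventures.PercRepro2.SwOutArmFlip
import Summits.Ventures.PercRepro2.SwOutArmThm
import Summits.Ventures.PercRepro2.SwOutReducible

/-!
# Bridge junctions: the sharp graph-theoretic core-free criterion (blind cell PercRepro2,
night-4 g28, 2026-08-28; proofs/NIGHT4-G28.md §3)

A CORE of a class point is a vertex `x ≠ h` of both clusters of `h` — joined to `h` by a red path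
and by a blue path, both inside `U` (the hull of `h` lies in `U` on the class).  Two such paths are
edge-disjoint, so a vertex SEPARATED FROM `h` BY ONE EDGE of `G[U]` (`x` not connected to `h` once
the edge `e₀` is deleted from `G[U]`: `x ∉ cluster (cutConfig U e₀) h`) is never a core: whichever
colour `e₀` has, the path of the other colour avoids `e₀` and stays inside `U`
(`not_core_of_cut`).  Hence, when every vertex of `U ∖ {h, o}` carries an outside edge, or no edge,
or is separated from `h` by one edge of `G[U]` (the BRIDGE JUNCTIONS), every `Q`-point of every
class is core-free and g10's arm principle `rigidOK_of_coreFree` gives the rigid inequality: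
**`rigidOK_of_bridges`**, `reducible_of_bridges`, **`swAll_of_bridges`**, **`sw_of_bridges`**.
Corollary **`sw_of_degree_le_one`**: rows 2′SW-ALL / (SW) on EVERY graph in which `h` carries at
most one edge (no loop at `h`, `l ≠ h`) — the single edge at `h` separates `h` from everything.
The pure junctions adjacent to `h` (SwOutPureJunction) are bridge junctions (their edge `h–u`);
the criterion is sharp for graph reasons: a vertex joined to `h` by two edge-disjoint paths of
`G[U]` is a core at the colouring that makes one path red and the other blue.
-/

namespace Summit.Ventures.PercRepro2

namespace LocRows

open Hull

variable {V : Type*} {E : Type*} [Fintype E] [DecidableEq E]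

open scoped Classical

variable {ends : E → Sym2 V}

section Cut

variable (ends) (U : Set V) (e₀ : E)

/-- The all-open colouring of the edges inside `U` other than `e₀`: `G[U] − e₀`. -/
noncomputable def cutConfig : Config E :=
  fun e => decide (e ∈ within ends U ∧ e ≠ e₀)

variable {ends U e₀}

omit [Fintype E] in
/-- An edge is open in `G[U] − e₀` iff it lies inside `U` and is not `e₀`. -/
lemma cutConfig_eq_true_iff {e : E} :
    cutConfig ends U e₀ e = true ↔ e ∈ within ends U ∧ e ≠ e₀ := by
  simp [cutConfig]

omit [Fintype E] in
/-- **A cluster of `h` inside `U` avoiding `e₀` lies in the cluster of `h` in `G[U] − e₀`**: the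
path from `h` to any vertex of the cluster uses open edges, which lie inside `U` and are not `e₀`. -/
theorem cluster_subset_cluster_cut {ζ : Config E} {h : V} (hT : cluster ends ζ h ⊆ U)
    (he₀ : ζ e₀ = false) : cluster ends ζ h ⊆ cluster ends (cutConfig ends U e₀) h := by
  intro x hx
  have key : cluster ends ζ h ⊆
      {y | y ∈ cluster ends ζ h ∧ y ∈ cluster ends (cutConfig ends U e₀) h} := by
    intro y hy
    refine mem_of_conn_of_closed (ends := ends) (ω := ζ) ?_
      ⟨mem_cluster_self _ _ _, mem_cluster_self _ _ _⟩ hy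
    rintro a ⟨haT, haC⟩ b hab
    have hbT : b ∈ cluster ends ζ h := mem_cluster_of_adj haT hab
    refine ⟨hbT, ?_⟩
    obtain ⟨_, e, he, hends⟩ := openGraph_adj.1 hab
    have hee₀ : e ≠ e₀ := by
      rintro rfl
      rw [he] at he₀
      exact Bool.noConfusion he₀
    refine mem_cluster_of_edge (ends := ends) haC (e := e) ?_ hends
    rw [cutConfig_eq_true_iff]
    exact ⟨⟨a, hT haT, b, hT hbT, hends⟩, hee₀⟩
  exact (key hx).2

omit [Fintype E] in
/-- The cluster of `h` in `G[U] − e₀` lies in any set containing `h` and closed under the edges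
inside `U` other than `e₀` (for instances). -/
lemma cluster_cut_subset {h : V} {S : Set V} (hh : h ∈ S)
    (hS : ∀ e x y, ends e = s(x, y) → e ∈ within ends U → e ≠ e₀ → x ∈ S → y ∈ S) :
    cluster ends (cutConfig ends U e₀) h ⊆ S := by
  intro v hv
  refine mem_of_conn_of_closed (ends := ends) (S := S) ?_ hh hv
  intro a ha b hab
  obtain ⟨_, e, he, hends⟩ := openGraph_adj.1 hab
  rw [cutConfig_eq_true_iff] at he
  exact hS e a b hends he.1 he.2 ha

omit [Fintype E] in
/-- **A vertex separated from `h` by one edge of `G[U]` is never a core** of a configuration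
whose hull of `h` lies in `U`. -/
theorem not_core_of_cut {ζ : Config E} {h x : V} (hcl : hull ends ζ h ⊆ U)
    (hx : x ∉ cluster ends (cutConfig ends U e₀) h) (hxT : x ∈ cluster ends ζ h)
    (hxTp : x ∈ cluster ends (blue ζ) h) : False := by
  have hT : cluster ends ζ h ⊆ U := fun y hy => hcl (Or.inl hy)
  have hTp : cluster ends (blue ζ) h ⊆ U := fun y hy => hcl (Or.inr hy)
  cases he : ζ e₀ with
  | false => exact hx (cluster_subset_cluster_cut hT he hxT)
  | true =>
    have he' : blue ζ e₀ = false := by simp [blue_apply, he]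
    exact hx (cluster_subset_cluster_cut hTp he' hxTp)

end Cut

section Bridges

variable {U : Set V} {ξ : Config E} {l h o : V}

/-- **Every `Q`-point of the class is core-free** when every vertex of `U ∖ {h, o}` carries an
outside edge, or no edge, or is separated from `h` by one edge of `G[U]`. -/
theorem coreFree_of_bridges
    (hbr : ∀ x ∈ U, x ≠ h → x ≠ o →
      (∃ e y, ends e = s(x, y) ∧ y ∉ U) ∨ (∀ e, x ∉ ends e) ∨
        ∃ e₀, x ∉ cluster ends (cutConfig ends U e₀) h)
    {ζ : Config E} (hζ : ζ ∈ swOutSide ends l h o U ξ) : CoreFree ends ζ h := by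
  intro x hxT hxTp
  by_contra hxh
  have hQ := (mem_swOutSide.1 hζ).1
  have hcl := (mem_swOutSide.1 hζ).2
  simp only [tgtU, Finset.mem_filter, Finset.mem_univ, true_and, Set.mem_setOf_eq, hull,
    Set.mem_union, not_or] at hQ
  obtain ⟨⟨hhA, _⟩, hoA, _⟩ := hQ
  have hxU : x ∈ U := (mem_outClass.1 hcl).2 (Or.inl hxT)
  by_cases hxo : x = o
  · subst hxo
    exact hhA (conn_trans hoA (conn_symm hxT))
  rcases hbr x hxU hxh hxo with ⟨e, y, hxy, hyU⟩ | hiso | ⟨e₀, hx⟩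
  · cases he : ζ e with
    | true => exact hyU ((mem_outClass.1 hcl).2 (Or.inl (mem_cluster_of_edge hxT he hxy)))
    | false =>
      have he' : blue ζ e = true := by rw [blue_eq_true_iff]; exact he
      exact hyU ((mem_outClass.1 hcl).2 (Or.inr (mem_cluster_of_edge hxTp he' hxy)))
  · obtain ⟨e, hxe⟩ := exists_edge_of_mem_cluster hxT hxh
    exact hiso e hxe
  · exact not_core_of_cut (mem_outClass.1 hcl).2 hx hxT hxTp

/-- **The rigid inequality on every class of a region with bridge junctions** (no loop at `h`):
the arm principle on a core-free class. -/
theorem rigidOK_of_bridges (hl : l ∉ U) (hloop : ∀ e, ends e ≠ s(h, h))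
    (hbr : ∀ x ∈ U, x ≠ h → x ≠ o →
      (∃ e y, ends e = s(x, y) ∧ y ∉ U) ∨ (∀ e, x ∉ ends e) ∨
        ∃ e₀, x ∉ cluster ends (cutConfig ends U e₀) h)
    (ξ : Config E) : RigidOK ends l h o U ξ :=
  fun _ h𝓔 => rigidOK_of_coreFree hl hloop (fun _ hζ => coreFree_of_bridges hbr hζ) h𝓔

/-- A region with bridge junctions is a base region of the series reduction. -/
theorem reducible_of_bridges (hl : l ∉ U) (hloop : ∀ e, ends e ≠ s(h, h))
    (hbr : ∀ x ∈ U, x ≠ h → x ≠ o →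
      (∃ e y, ends e = s(x, y) ∧ y ∉ U) ∨ (∀ e, x ∉ ends e) ∨
        ∃ e₀, x ∉ cluster ends (cutConfig ends U e₀) h) : Reducible l h o ends U :=
  Reducible.base ends U fun ξ => rigidOK_of_bridges hl hloop hbr ξ

/-- **Row 2′SW-ALL on every graph with bridge junctions** in the region `{l}ᶜ`: every vertex
other than `l, h, o` is joined to `l`, or has no edge, or is separated from `h` by one edge of
`G − l`; no loop at `h`. -/
theorem swAll_of_bridges (hlh : l ≠ h) (hloop : ∀ e, ends e ≠ s(h, h))
    (hbr : ∀ x, x ≠ l → x ≠ h → x ≠ o →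
      (∃ e, ends e = s(x, l)) ∨ (∀ e, x ∉ ends e) ∨
        ∃ e₀, x ∉ cluster ends (cutConfig ends ({l}ᶜ) e₀) h) : SwAll ends l h o := by
  refine swAll_of_reducible l h o hlh (reducible_of_bridges (by simp) hloop ?_)
  intro x hx hxh hxo
  rcases hbr x (by simpa using hx) hxh hxo with ⟨e, he⟩ | hiso | hcut
  · exact Or.inl ⟨e, l, he, by simp⟩
  · exact Or.inr (Or.inl hiso)
  · exact Or.inr (Or.inr hcut)

/-- **Row (SW) on every graph with bridge junctions** (see `swAll_of_bridges`). -/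
theorem sw_of_bridges (hlh : l ≠ h) (hloop : ∀ e, ends e ≠ s(h, h))
    (hbr : ∀ x, x ≠ l → x ≠ h → x ≠ o →
      (∃ e, ends e = s(x, l)) ∨ (∀ e, x ∉ ends e) ∨
        ∃ e₀, x ∉ cluster ends (cutConfig ends ({l}ᶜ) e₀) h) : Sw ends l h o :=
  sw_of_swAll ends (swAll_of_bridges hlh hloop hbr)

end Bridges

section DegreeOne

variable {U : Set V} {l h o : V}

omit [Fintype E] in
/-- When `e₀` is the only edge at `h`, the cluster of `h` in `G[U] − e₀` is `{h}`. -/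
lemma cluster_cut_eq_singleton {e₀ : E} (hdeg : ∀ e, h ∈ ends e → e = e₀) :
    cluster ends (cutConfig ends U e₀) h = {h} := by
  ext x
  constructor
  · intro hx
    refine mem_of_conn_of_closed (ends := ends) (ω := cutConfig ends U e₀) (S := {h}) ?_ rfl hx
    intro a ha b hab
    rw [Set.mem_singleton_iff] at ha
    subst ha
    obtain ⟨_, e, he, hends⟩ := openGraph_adj.1 hab
    rw [cutConfig_eq_true_iff] at he
    exfalso
    exact he.2 (hdeg e (by rw [hends]; exact Sym2.mem_mk_left _ _))
  · rintro rfl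
    exact mem_cluster_self _ _ _

/-- **The rigid inequality on every class of every region when `h` carries at most one edge**
(no loop at `h`). -/
theorem rigidOK_of_degree_le_one (hl : l ∉ U) (hloop : ∀ e, ends e ≠ s(h, h))
    (hdeg : ∀ e e', h ∈ ends e → h ∈ ends e' → e = e') (ξ : Config E) :
    RigidOK ends l h o U ξ := by
  refine rigidOK_of_bridges hl hloop ?_ ξ
  intro x _ hxh _
  by_cases hE : ∃ e₀, h ∈ ends e₀
  · obtain ⟨e₀, he₀⟩ := hE
    refine Or.inr (Or.inr ⟨e₀, ?_⟩)
    rw [cluster_cut_eq_singleton (fun e he => hdeg e e₀ he he₀)]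
    exact hxh
  · -- `h` is isolated: the cluster of `h` in every colouring is `{h}`; any edge separates
    by_cases hx : ∃ e, x ∈ ends e
    · obtain ⟨e, _⟩ := hx
      refine Or.inr (Or.inr ⟨e, ?_⟩)
      intro hxc
      refine hxh ?_
      have key : cluster ends (cutConfig ends U e) h ⊆ {h} := by
        intro y hy
        refine mem_of_conn_of_closed (ends := ends) (ω := cutConfig ends U e) (S := {h}) ?_ rfl hy
        intro a ha b hab
        rw [Set.mem_singleton_iff] at ha
        subst ha
        obtain ⟨_, e', _, hends⟩ := openGraph_adj.1 hab
        exact absurd ⟨e', by rw [hends]; exact Sym2.mem_mk_left _ _⟩ hE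
      exact key hxc
    · exact Or.inr (Or.inl fun e he => hx ⟨e, he⟩)

/-- **Row 2′SW-ALL on every graph in which `h` carries at most one edge** (no loop at `h`). -/
theorem swAll_of_degree_le_one (hlh : l ≠ h) (hloop : ∀ e, ends e ≠ s(h, h))
    (hdeg : ∀ e e', h ∈ ends e → h ∈ ends e' → e = e') : SwAll ends l h o :=
  swAll_of_reducible l h o hlh
    (Reducible.base ends ({l}ᶜ) fun ξ => rigidOK_of_degree_le_one (by simp) hloop hdeg ξ)

/-- **Row (SW) on every graph in which `h` carries at most one edge** (no loop at `h`). -/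
theorem sw_of_degree_le_one (hlh : l ≠ h) (hloop : ∀ e, ends e ≠ s(h, h))
    (hdeg : ∀ e e', h ∈ ends e → h ∈ ends e' → e = e') : Sw ends l h o :=
  sw_of_swAll ends (swAll_of_degree_le_one hlh hloop hdeg)

end DegreeOne

end LocRows

end Summit.Ventures.PercRepro2
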